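import Summits.CriticalPhenomena.PercolationContinuityZ3.Theorems.PercNearOneGluingNoHeavyLowerTailSahiCombTriWCertGen
import Summits.CriticalPhenomena.PercolationContinuityZ3.Theorems.PercNearOneGluingNoHeavyLowerTailSahiCombTranslateRank

/-!
# The q-zeta blocks of CERT-GEN(q) are of full rank for EVERY `q ≠ 0`: q-antipodal basis (q-C1), its translate form (q-TR),
# and the two tilted blocks `D₃ → A`, `D₁ → B`

Support file of the one-cut programme (crux `NoHeavyLowerTail`, stmt-CriticalPhenomena-4575; cell `prim-masterthm`, seat P5 gen 19;
memo `FROM-prim-masterthm-p5-g19-QZETA-CHANNELS.md` §1).  The typed conjecture `FiveUpSet.CertGenKernel` (`…SahiCombTriWCertGen`) asks that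
the two-copy certificate with q-zeta blocks `ζ_q(d,u) = [d ⊆ u]·q^{#(u \ d)}` (`FiveUpSet.qzeta`) on `D₁ → B` and `D₃ → A` have trivial kernel for
some `q`.  Any elimination over `ℚ(q)` starts from the fact that EACH BLOCK ALONE is of full rank, and for the tilted blocks this holds for every
`q ≠ 0`, not only generically: `ζ_q(e,t) = q^{#t} · q^{-#e} · [e ⊆ t]`, so a q-zeta relation `Σ_e g e ζ_q(e,t) = 0` on an up-set is a plain zeta
relation for the rescaled coefficients `g e / q^{#e}`, and C1 (`eq_zero_of_zeta_sum_eq_zero`, the antipodal basis) resp. the translate-rank lemma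
(`eq_zero_of_zeta_sum_eq_zero_transl`) apply.

* `qzeta_eq_div_mul_zeta` — `ζ_q(e,t) = (q^{#t} / q^{#e}) · [e ⊆ t]` for `q ≠ 0`;
* **`eq_zero_of_qzeta_sum_eq_zero`** (q-C1) — `W` an up-set, `q ≠ 0`, `g` supported on `refl W`, `Σ_e g e ζ_q(e,t) = 0` for all `t ∈ W` ⟹ `g = 0`;
* **`eq_zero_of_qzeta_sum_eq_zero_transl`** (q-TR) — the same with the equations on a translate `transl s W`;
* **`certGen_blockD3A_eq_zero`** — the `D₃ → A` block of CERT-GEN(q): `c` supported on `refl (X ∩ Y)` with `Σ_d c d ζ_q(d,u) = 0` on `X ∩ Y` ⟹ `c = 0`;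
* **`certGen_blockD1B_eq_zero`** — the `D₁ → B` block: `a` supported on `refl X ∩ Y` with `Σ_d a d ζ_q(d,u) = 0` on `X ∩ Y` ⟹ `a = 0`
  (the relation extends from `X ∩ Y` to `X` for free, because `a` lives inside the up-set `Y`).
What is NOT here: the coupling of the blocks, i.e. `CertGenKernel` itself (OPEN; memo §2–§4 for the reduced "two-channel" system).
HONEST LABEL: elementary lemmas, all proved (std axioms). [this work]
-/

namespace Summit.CriticalPhenomena.PercolationContinuityZ3.Theorems

namespace FiveUpSet

open Finset

variable {α : Type} [DecidableEq α] [Fintype α]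

/-! ### q-zeta as a rescaled zeta -/

omit [Fintype α] in
/-- For `q ≠ 0`: `ζ_q(e,t) = (q^{#t} / q^{#e}) · [e ⊆ t]`. [this work] -/
theorem qzeta_eq_div_mul_zeta {q : ℚ} (hq : q ≠ 0) (e t : Finset α) :
    qzeta q e t = q ^ t.card / q ^ e.card * (if e ⊆ t then (1 : ℚ) else 0) := by
  unfold qzeta
  split_ifs with h
  · rw [mul_one, card_sdiff_of_subset h, pow_sub₀ q hq (card_le_card h), div_eq_mul_inv]
  · rw [mul_zero]

omit [Fintype α] in
/-- The rescaling behind q-C1: `(g e / q^{#e}) · [e ⊆ t] = (g e · ζ_q(e,t)) / q^{#t}` for `q ≠ 0`. [this work] -/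
theorem div_pow_mul_zeta_eq {q : ℚ} (hq : q ≠ 0) (g : Finset α → ℚ) (e t : Finset α) :
    g e / q ^ e.card * (if e ⊆ t then (1 : ℚ) else 0) = g e * qzeta q e t / q ^ t.card := by
  rw [qzeta_eq_div_mul_zeta hq]
  have ht : q ^ t.card ≠ 0 := pow_ne_zero _ hq
  have he : q ^ e.card ≠ 0 := pow_ne_zero _ hq
  field_simp

/-! ### q-C1: the q-antipodal basis -/

/-- **q-C1.**  For an up-set `W`, `q ≠ 0` and `g` supported on `refl W` (`g e ≠ 0 → eᶜ ∈ W`): if `Σ_e g e ζ_q(e,t) = 0` for every `t ∈ W`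
then `g = 0` — the q-zeta functions of `refl W` restricted to `W` are linearly independent for EVERY non-zero `q` (for `q = 1` this is C1,
`eq_zero_of_zeta_sum_eq_zero`; `q = 0` genuinely fails). Proof: divide the `t`-th equation by `q^{#t}` and apply C1 to `e ↦ g e / q^{#e}`.
[this work] -/
theorem eq_zero_of_qzeta_sum_eq_zero {W : Finset (Finset α)} (hW : IsUpperSet (W : Set (Finset α))) {q : ℚ} (hq : q ≠ 0)
    (g : Finset α → ℚ) (hg : ∀ e, g e ≠ 0 → eᶜ ∈ W)
    (h : ∀ t ∈ W, ∑ e, g e * qzeta q e t = 0) : ∀ e, g e = 0 := by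
  set g' : Finset α → ℚ := fun e => g e / q ^ e.card with hg'
  have hg'supp : ∀ e, g' e ≠ 0 → eᶜ ∈ W := by
    intro e he
    apply hg e
    intro h0
    apply he
    simp only [hg', h0, zero_div]
  have h' : ∀ t ∈ W, ∑ e, g' e * (if e ⊆ t then (1 : ℚ) else 0) = 0 := by
    intro t ht
    have hrw : ∀ e, g' e * (if e ⊆ t then (1 : ℚ) else 0) = g e * qzeta q e t / q ^ t.card := fun e =>
      div_pow_mul_zeta_eq hq g e t
    simp_rw [hrw]
    rw [← Finset.sum_div, h t ht, zero_div]
  have hz := eq_zero_of_zeta_sum_eq_zero hW g' hg'supp h'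
  intro e
  have := hz e
  simp only [hg'] at this
  rcases div_eq_zero_iff.1 this with h0 | h0
  · exact h0
  · exact absurd h0 (pow_ne_zero _ hq)

/-- **q-TR.**  The same on a translate: for an up-set `W`, any `s`, `q ≠ 0` and `g` supported on `refl W`, the relations
`Σ_e g e ζ_q(e,t) = 0` for all `t ∈ transl s W` force `g = 0` (for `q = 1` this is `eq_zero_of_zeta_sum_eq_zero_transl`). [this work] -/
theorem eq_zero_of_qzeta_sum_eq_zero_transl {W : Finset (Finset α)} (hW : IsUpperSet (W : Set (Finset α))) (s : Finset α)
    {q : ℚ} (hq : q ≠ 0) (g : Finset α → ℚ) (hg : ∀ e, g e ≠ 0 → eᶜ ∈ W)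
    (h : ∀ t ∈ transl s W, ∑ e, g e * qzeta q e t = 0) : ∀ e, g e = 0 := by
  set g' : Finset α → ℚ := fun e => g e / q ^ e.card with hg'
  have hg'supp : ∀ e, g' e ≠ 0 → eᶜ ∈ W := by
    intro e he
    apply hg e
    intro h0
    apply he
    simp only [hg', h0, zero_div]
  have h' : ∀ t ∈ transl s W, ∑ e, g' e * (if e ⊆ t then (1 : ℚ) else 0) = 0 := by
    intro t ht
    have hrw : ∀ e, g' e * (if e ⊆ t then (1 : ℚ) else 0) = g e * qzeta q e t / q ^ t.card := fun e =>
      div_pow_mul_zeta_eq hq g e t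
    simp_rw [hrw]
    rw [← Finset.sum_div, h t ht, zero_div]
  have hz := eq_zero_of_zeta_sum_eq_zero_transl hW s g' hg'supp h'
  intro e
  have := hz e
  simp only [hg'] at this
  rcases div_eq_zero_iff.1 this with h0 | h0
  · exact h0
  · exact absurd h0 (pow_ne_zero _ hq)

/-! ### The two tilted blocks of CERT-GEN(q) -/

/-- **Block `D₃ → A` of CERT-GEN(q) is non-singular for every `q ≠ 0`.**  If `c` is supported on `refl (X ∩ Y)` and
`Σ_d c d ζ_q(d,u) = 0` for all `u ∈ X ∩ Y` (with `X, Y` up-sets), then `c = 0`. [this work] -/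
theorem certGen_blockD3A_eq_zero (X Y : Finset (Finset α)) (hX : IsUpperSet (X : Set (Finset α)))
    (hY : IsUpperSet (Y : Set (Finset α))) {q : ℚ} (hq : q ≠ 0) (c : Finset α → ℚ)
    (hc : ∀ d, c d ≠ 0 → d ∈ refl (X ∩ Y)) (h : ∀ u, u ∈ X ∩ Y → ∑ d, c d * qzeta q d u = 0) : ∀ d, c d = 0 := by
  have hW : IsUpperSet ((X ∩ Y : Finset (Finset α)) : Set (Finset α)) := by
    rw [coe_inter]; exact hX.inter hY
  exact eq_zero_of_qzeta_sum_eq_zero hW hq c (fun d hd => mem_refl.1 (hc d hd)) h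

/-- **Block `D₁ → B` of CERT-GEN(q) has independent rows for every `q ≠ 0`.**  If `a` is supported on `refl X ∩ Y` and
`Σ_d a d ζ_q(d,u) = 0` for all `u ∈ X ∩ Y` (with `X, Y` up-sets), then `a = 0`.  The equations extend from `X ∩ Y` to all of `X`:
for `u ∈ X \ Y` every term vanishes, since `a d ≠ 0` forces `d ∈ Y`, and `d ⊆ u` would put `u` in the up-set `Y`; then q-C1 for `X` applies
(`refl X ∩ Y ⊆ refl X`). [this work] -/
theorem certGen_blockD1B_eq_zero (X Y : Finset (Finset α)) (hX : IsUpperSet (X : Set (Finset α)))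
    (hY : IsUpperSet (Y : Set (Finset α))) {q : ℚ} (hq : q ≠ 0) (a : Finset α → ℚ)
    (ha : ∀ d, a d ≠ 0 → d ∈ refl X ∩ Y) (h : ∀ u, u ∈ X ∩ Y → ∑ d, a d * qzeta q d u = 0) : ∀ d, a d = 0 := by
  refine eq_zero_of_qzeta_sum_eq_zero hX hq a (fun d hd => mem_refl.1 (mem_inter.1 (ha d hd)).1) ?_
  intro t ht
  by_cases hty : t ∈ Y
  · exact h t (mem_inter.2 ⟨ht, hty⟩)
  · refine Finset.sum_eq_zero fun d _ => ?_
    by_cases had : a d = 0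
    · rw [had, zero_mul]
    · have hdY : d ∈ Y := (mem_inter.1 (ha d had)).2
      have hdt : ¬ d ⊆ t := fun hsub => hty (hY hsub hdY)
      rw [qzeta_eq_zero_of_not_subset hdt, mul_zero]

end FiveUpSet

end Summit.CriticalPhenomena.PercolationContinuityZ3.Theorems
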